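import Summits.Langlands.Langlands.Theorems.SqrtFiveQuarticCoversCertB3E7MordellWeilE7

/-!
# Route `Langlands/SqrtFiveQuarticCovers`, certificate `CertB3E7` (sheet 4.5; stmt-Langlands-23416)
# BY NAME modulo the model identification ALONE

With the registered stub `MordellWeilE7` now a THEOREM (eng-7 g5, p682119
`…CertB3E7MordellWeilE7.lean`: `mordellWeilE7_of_ratPoints W_ratPoints W5Descent.ratPoints`, on top of
p677449 / p679899 / p680761), eng-7 g4's census-free
`certB3E7_of_modelIdentificationInf_of_mordellWeil (hK1inf) (hE49)` (p675221) loses its Mordell–Weil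
binder: `certB3E7_of_modelIdentificationInf (hK1inf) : CertB3E7`.  So sheet 4.5 rests on ONE named
input, the model identification `ModelIdentificationB3E7Inf` (FLS Lemma 4.2 + `Ψ₃`, chart at infinity
included; kind MODEL, «N1» of the NAMED-INPUT TABLE).

HONEST STATUS: CONDITIONAL on that model identification (not proved: Mathlib has no modular curves); the
discharged Mordell–Weil input is an elementary kernel theorem about `E(ℚ)` of two explicit curves, not
a modularity or BSD statement; nothing here proves modularity of a new class.  References:
[FreitasLeHungSiksek2015] Lemma 4.2 (arXiv:1310.7088 p. 28); cell records NAMED-INPUT-TABLE rows 7–8.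
-/

noncomputable section

set_option linter.dupNamespace false -- project-wide option; `Summit.Langlands.Langlands` is the mandated namespace

open scoped MatrixGroups NumberField Matrix Polynomial IntermediateField
open NumberField Polynomial
open Summit.Langlands.Langlands.Theses.SqrtFiveQuarticCovers

namespace Summit.Langlands.Langlands.Theorems.SqrtFiveQuarticCovers

/-- **`CertB3E7` (stmt-Langlands-23416, sheet 4.5) BY NAME modulo `ModelIdentificationB3E7Inf`
ALONE**: `certB3E7_of_modelIdentificationInf_of_mordellWeil hK1inf MordellWeilE7`.  CONDITIONAL on the
model identification (NAMED, kind MODEL); «a certified finite datum is not a modularity statement»;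
nothing here proves modularity of a new class. [cite: FreitasLeHungSiksek2015, Lemma 4.2 (arXiv:1310.7088 p. 28)] -/
theorem certB3E7_of_modelIdentificationInf
    (hK1inf : ∀ (K : Type) [Field K] [NumberField K], Module.finrank ℚ K = 4 → (∃ r : K, r ^ 2 = 5) →
        ∀ E : WeierstrassCurve (NumberField.RingOfIntegers K), E.Δ ≠ 0 →
          (∃ ρ : Literature.NumberTheory.GaloisRepresentations.FramedGaloisRep K (ZMod 3) 2, (∃ e : (E.baseChange K).geomTorsion ((3 : ℕ) : ℤ) ≃+ (Fin 2 → ZMod 3), ∀ (σ : Field.absoluteGaloisGroup K) (P : (E.baseChange K).geomTorsion ((3 : ℕ) : ℤ)), e (σ • P) = ((ρ σ : GL (Fin 2) (ZMod 3)) : Matrix (Fin 2) (Fin 2) (ZMod 3)) *ᵥ (e P)) ∧ ((∀ σ : Field.absoluteGaloisGroup K, (((ρ σ : GL (Fin 2) (ZMod 3)) : Matrix (Fin 2) (Fin 2) (ZMod 3)) 1 0 = 0)))) →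
          (∃ ρ : Literature.NumberTheory.GaloisRepresentations.FramedGaloisRep K (ZMod 7) 2, (∃ e : (E.baseChange K).geomTorsion ((7 : ℕ) : ℤ) ≃+ (Fin 2 → ZMod 7), ∀ (σ : Field.absoluteGaloisGroup K) (P : (E.baseChange K).geomTorsion ((7 : ℕ) : ℤ)), e (σ • P) = ((ρ σ : GL (Fin 2) (ZMod 7)) : Matrix (Fin 2) (Fin 2) (ZMod 7)) *ᵥ (e P)) ∧ ((∀ σ : Field.absoluteGaloisGroup K, (ρ σ : GL (Fin 2) (ZMod 7)) ∈ Subgroup.closure ({(⟨!![0, 5; 3, 0], !![0, 5; 3, 0], by decide, by decide⟩ : GL (Fin 2) (ZMod 7)), (⟨!![5, 0; 3, 2], !![3, 0; 6, 4], by decide, by decide⟩ : GL (Fin 2) (ZMod 7))} : Set (GL (Fin 2) (ZMod 7)))))) →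
          ((E.baseChange K).c₄ ^ 3 = 1728 * (E.baseChange K).Δ ∨
           (∃ x₁ y₁ x₂ y₂ : K, y₁ ^ 2 = 7 * (16 * x₁ ^ 4 + 68 * x₁ ^ 3 + 111 * x₁ ^ 2 + 62 * x₁ + 11) ∧ y₂ ^ 2 = 7 * (16 * x₂ ^ 4 + 68 * x₂ ^ 3 + 111 * x₂ ^ 2 + 62 * x₂ + 11) ∧
            ((x₁ ^ 3 + x₁ ^ 2 - 2 * x₁ - 1) ^ 7) ≠ 0 ∧
            (E.baseChange K).c₄ ^ 3 * ((x₁ ^ 3 + x₁ ^ 2 - 2 * x₁ - 1) ^ 7) = ((3 * x₁ + 1) ^ 3 * (4 * x₁ ^ 2 + 5 * x₁ + 2) ^ 3 * (x₁ ^ 2 + 3 * x₁ + 4) ^ 3 * (x₁ ^ 2 + 10 * x₁ + 4) ^ 3) * (E.baseChange K).Δ ∧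
            ((3 * x₂ ^ 2 + 6 * x₂ + 2) ^ 2 * x₁ ^ 4 + (36 * x₂ ^ 4 + 125 * x₂ ^ 3 + 138 * x₂ ^ 2 + 60 * x₂ + 9) * x₁ ^ 3 + (48 * x₂ ^ 4 + 138 * x₂ ^ 3 + 111 * x₂ ^ 2 + 33 * x₂ + 3) * x₁ ^ 2 + (24 * x₂ ^ 4 + 60 * x₂ ^ 3 + 33 * x₂ ^ 2 + 5 * x₂) * x₁ + (4 * x₂ ^ 4 + 9 * x₂ ^ 3 + 3 * x₂ ^ 2)) = 0) ∨
           (∃ x₁ y₁ z : K, y₁ ^ 2 = 7 * (16 * x₁ ^ 4 + 68 * x₁ ^ 3 + 111 * x₁ ^ 2 + 62 * x₁ + 11) ∧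
            ((x₁ ^ 3 + x₁ ^ 2 - 2 * x₁ - 1) ^ 7) ≠ 0 ∧
            (E.baseChange K).c₄ ^ 3 * ((x₁ ^ 3 + x₁ ^ 2 - 2 * x₁ - 1) ^ 7) = ((3 * x₁ + 1) ^ 3 * (4 * x₁ ^ 2 + 5 * x₁ + 2) ^ 3 * (x₁ ^ 2 + 3 * x₁ + 4) ^ 3 * (x₁ ^ 2 + 10 * x₁ + 4) ^ 3) * (E.baseChange K).Δ ∧
            (3 * x₁ ^ 2 + 6 * x₁ + 2) ^ 2 = 0 ∧ z ^ 2 = 7))) :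
    CertB3E7 :=
  certB3E7_of_modelIdentificationInf_of_mordellWeil hK1inf MordellWeilE7

end Summit.Langlands.Langlands.Theorems.SqrtFiveQuarticCovers

end
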